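import Literature.AlgebraicGeometry.Modules.IdealMulMaps
import Literature.AlgebraicGeometry.Modules.IsoOfSectionsOnBasis
import Literature.AlgebraicGeometry.Modules.RestrictOpenCoh
import HarnessLib

/-!
# `(𝒥M)|_Z ≅ 𝒥|_Z · M|_Z`: the ideal product commutes with restriction along an open immersion

Topic: `Literature/AlgebraicGeometry/Modules`. PROVED, fact-free, definition-free. Plumbing for step S6 of
the F-53 route (δ) «domination + divisorial twist» (D-0154 (2) RES inputs cell, seats res-inputs-p-9b /
res-inputs-p-9c): the local Serre-vanishing lemma (`Resolution/BlowupSerreVanishingLocal.lean`) computes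
`Ȟ¹` of `𝒥ⁿ·G` on the preimage `r⁻¹U ≅ Bl_{J(U)}(Spec Γ(X,U))` of an affine open under a blowing up, i.e.
after restricting along an open immersion `φ : Z ⟶ S′`; this file identifies the restricted module.

THE MATHEMATICS (Stacks 01CL; Görtz–Wedhorn I (7.15), Prop. 7.14; Hartshorne II Prop. 5.4). For a sheaf of
ideals `𝒥 ⊆ 𝒪_{S′}` (Mathlib `IdealSheafData`), an `𝒪_{S′}`-module `M` and an open immersion `φ : Z → S′`,
the subsheaf `𝒥M ⊆ M` (tree `Modules.idealMul`: sections that are locally sums of products) restricts to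
the subsheaf `(𝒥|_Z)(M|_Z) ⊆ M|_Z`, where `𝒥|_Z = J.comap φ` and `M|_Z = M.restrict φ` (Mathlib; sections
`Γ(W, M|_Z) = Γ(φW, M)`): both are the sections of `M` over `φ(W)` that are locally in `𝒥(V)·Γ(V, M)`,
because `φ` identifies the affine opens of `Z` with the affine opens of `S′` inside `φ(Z)` together with
their coordinate rings (`Scheme.Hom.appIso`) and ideals (`IdealSheafData.ideal_comap_of_isOpenImmersion`).

## Main statements

* `mem_ideal_smul_top_restrict_iff` — on an affine `W ⊆ Z`: `x ∈ 𝒥|_Z(W)·Γ(W, M|_Z) ↔ x ∈ 𝒥(φW)·Γ(φW, M)`.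
* `isIdealMulSection_restrict_of_image` / `isIdealMulSection_image_of_restrict` — product sections of `M`
  over `φ(V)` are exactly the product sections of `M|_Z` over `V`.
* `isIso_idealMulLift_restrict`, `nonempty_restrict_idealMul_iso` — **`(𝒥M)|_Z ≅ 𝒥|_Z · M|_Z`**: the lift
  of the restricted inclusion `(𝒥M)|_Z ⟶ M|_Z` through `𝒥|_Z · M|_Z ⟶ M|_Z` is an isomorphism.
* `torsionFree_restrict` — if no non-zero section of `M` over an affine open is killed by `𝒥`, the same
  holds for `M|_Z` and `𝒥|_Z`.

No step of any summit is discharged here. AI-written; AI review is weaker than expert review.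

## References
* The Stacks Project, Tag 01CL (Modules, §17.13–17.15: the submodule `𝒥ℱ`); Tag 01R2 (open immersions and
  restriction of modules). [StacksProject]
* U. Görtz, T. Wedhorn, *Algebraic Geometry I* (2nd ed. 2020), (7.15) p. 186 and Prop. 7.14. [GortzWedhorn2020]
* R. Hartshorne, *Algebraic Geometry* (1977), II Prop. 5.4 (p. 113) (restriction of quasi-coherent modules to
  opens). [Hartshorne1977]
-/

noncomputable section

universe u

open CategoryTheory AlgebraicGeometry TopologicalSpace Opposite

namespace Literature.AlgebraicGeometry.Modules

variable {Z S' : Scheme.{u}} (φ : Z ⟶ S') [IsOpenImmersion φ] (G : S'.Modules) (K : S'.IdealSheafData)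

/-- **`𝒥|_Z(W) · Γ(W, M|_Z) = 𝒥(φW) · Γ(φW, M)`** as subsets of `Γ(φW, M) = Γ(W, M|_Z)` (`W` affine): the
restricted scalar action is `a • x = a′ • x` with `a ↔ a′` under `Γ(W, 𝒪_Z) ≅ Γ(φW, 𝒪_{S′})`, and
`(𝒥|_Z)(W) ↔ 𝒥(φW)` under the same isomorphism (Mathlib `ideal_comap_of_isOpenImmersion`).
[cite: StacksProject, Tag 01CL (Modules, §17.13–17.15)] [cite: Hartshorne1977, II Prop. 5.4 (p. 113)] -/
theorem mem_ideal_smul_top_restrict_iff (W : Z.affineOpens) (x : Γ(G.restrict φ, (W : Z.Opens))) :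
    x ∈ (K.comap φ).ideal W • (⊤ : Submodule Γ(Z, (W : Z.Opens)) Γ(G.restrict φ, (W : Z.Opens))) ↔
      (show Γ(G, φ ''ᵁ (W : Z.Opens)) from x) ∈
        K.ideal ⟨φ ''ᵁ (W : Z.Opens), W.2.image_of_isOpenImmersion φ⟩ •
          (⊤ : Submodule Γ(S', φ ''ᵁ (W : Z.Opens)) Γ(G, φ ''ᵁ (W : Z.Opens))) := by
  have hI : ∀ a : Γ(Z, (W : Z.Opens)), a ∈ (K.comap φ).ideal W ↔
      (φ.appIso (W : Z.Opens)).inv a ∈ K.ideal ⟨φ ''ᵁ (W : Z.Opens), W.2.image_of_isOpenImmersion φ⟩ := by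
    intro a
    rw [Scheme.IdealSheafData.ideal_comap_of_isOpenImmersion, Ideal.mem_comap]
  constructor
  · intro hx
    refine Submodule.smul_induction_on hx (fun a ha m _ => ?_) (fun x y hx hy => Submodule.add_mem _ hx hy)
    rw [restrict_smul]
    exact Submodule.smul_mem_smul ((hI a).mp ha) Submodule.mem_top
  · intro hx
    refine Submodule.smul_induction_on
      (p := fun y : Γ(G, φ ''ᵁ (W : Z.Opens)) => (show Γ(G.restrict φ, (W : Z.Opens)) from y) ∈
        (K.comap φ).ideal W • (⊤ : Submodule Γ(Z, (W : Z.Opens)) Γ(G.restrict φ, (W : Z.Opens))))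
      hx (fun a ha m _ => ?_) (fun x y hx hy => Submodule.add_mem _ hx hy)
    have ha' : (φ.appIso (W : Z.Opens)).hom a ∈ (K.comap φ).ideal W := by
      rw [hI]
      change ((φ.appIso (W : Z.Opens)).hom ≫ (φ.appIso (W : Z.Opens)).inv) a ∈
        K.ideal ⟨φ ''ᵁ (W : Z.Opens), W.2.image_of_isOpenImmersion φ⟩
      rw [Iso.hom_inv_id]
      exact ha
    change (show Γ(G.restrict φ, (W : Z.Opens)) from a • m) ∈ _
    have hsmul : ((φ.appIso (W : Z.Opens)).hom a • (show Γ(G.restrict φ, (W : Z.Opens)) from m)) =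
        (show Γ(G.restrict φ, (W : Z.Opens)) from a • m) := by
      rw [restrict_smul]
      change (((φ.appIso (W : Z.Opens)).hom ≫ (φ.appIso (W : Z.Opens)).inv) a • m : Γ(G, φ ''ᵁ (W : Z.Opens))) = a • m
      rw [Iso.hom_inv_id]
      rfl
    rw [← hsmul]
    exact Submodule.smul_mem_smul ha' Submodule.mem_top

/-- Product sections of `M` over `φ(V)` are product sections of `M|_Z` over `V` for the pulled-back ideal.
[cite: StacksProject, Tag 01CL (Modules, §17.13–17.15)] -/
theorem isIdealMulSection_restrict_of_image {V : Z.Opens} {t : Γ(G, φ ''ᵁ V)}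
    (ht : IsIdealMulSection G K (φ ''ᵁ V) t) :
    IsIdealMulSection (G.restrict φ) (K.comap φ) V (show Γ(G.restrict φ, V) from t) := by
  intro y hy
  obtain ⟨W', hW'V, hyW', hmem⟩ := ht (φ y) ⟨y, hy, rfl⟩
  obtain ⟨W, hW, hyW, hWle⟩ := Opens.isBasis_iff_nbhd.mp Z.isBasis_affineOpens
    (show y ∈ V ⊓ φ ⁻¹ᵁ (W' : S'.Opens) from ⟨hy, hyW'⟩)
  have hWV : W ≤ V := hWle.trans inf_le_left
  have hWW' : φ ''ᵁ W ≤ (W' : S'.Opens) := by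
    rintro _ ⟨z, hz, rfl⟩
    exact (hWle hz).2
  refine ⟨⟨W, hW⟩, hWV, hyW, ?_⟩
  rw [mem_ideal_smul_top_restrict_iff φ G K ⟨W, hW⟩]
  have h2 := map_mem_ideal_smul_top (V := W') (V' := ⟨φ ''ᵁ W, hW.image_of_isOpenImmersion φ⟩) hWW' hmem
  rw [map_map] at h2
  exact h2

/-- Conversely, product sections of `M|_Z` over `V` are product sections of `M` over `φ(V)`.
[cite: StacksProject, Tag 01CL (Modules, §17.13–17.15)] -/
theorem isIdealMulSection_image_of_restrict {V : Z.Opens} {t : Γ(G, φ ''ᵁ V)}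
    (ht : IsIdealMulSection (G.restrict φ) (K.comap φ) V (show Γ(G.restrict φ, V) from t)) :
    IsIdealMulSection G K (φ ''ᵁ V) t := by
  rintro _ ⟨y, hy, rfl⟩
  obtain ⟨W, hWV, hyW, hmem⟩ := ht y hy
  refine ⟨⟨φ ''ᵁ (W : Z.Opens), W.2.image_of_isOpenImmersion φ⟩, φ.image_mono hWV, ⟨y, hyW, rfl⟩, ?_⟩
  rw [mem_ideal_smul_top_restrict_iff φ G K W] at hmem
  exact hmem

/-- The sections of the restricted inclusion `(𝒥M)|_Z ⟶ M|_Z` are product sections for `𝒥|_Z`.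
[cite: StacksProject, Tag 01CL (Modules, §17.13–17.15)] -/
theorem isIdealMulSection_restrictFunctor_map_idealMulι (V : Z.Opens)
    (s : Γ((idealMul G K).restrict φ, V)) :
    IsIdealMulSection (G.restrict φ) (K.comap φ) V
      (((Scheme.Modules.restrictFunctor φ).map (idealMulι G K)).app V s) :=
  isIdealMulSection_restrict_of_image φ G K
    (isIdealMulSection_idealMulι_app G K (φ ''ᵁ V) (show Γ(idealMul G K, φ ''ᵁ V) from s))

/-- **`(𝒥M)|_Z ≅ 𝒥|_Z · M|_Z` along an open immersion**: the lift `(𝒥M)|_Z ⟶ 𝒥|_Z · M|_Z` of the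
restricted inclusion `(𝒥M)|_Z ⟶ M|_Z` (tree `idealMulLift`) is bijective on every open — both sides are the
product sections of `M` over `φ(V)` — hence an isomorphism.
[cite: StacksProject, Tag 01CL (Modules, §17.13–17.15)] [cite: GortzWedhorn2020, (7.15) p. 186] -/
theorem idealMulLift_restrict_app_bijective (V : Z.Opens) :
    Function.Bijective ((idealMulLift ((Scheme.Modules.restrictFunctor φ).map (idealMulι G K))
      (isIdealMulSection_restrictFunctor_map_idealMulι φ G K)).app V) := by
  have hval : ∀ s : Γ((idealMul G K).restrict φ, V),
      (idealMulι (G.restrict φ) (K.comap φ)).app V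
        ((idealMulLift ((Scheme.Modules.restrictFunctor φ).map (idealMulι G K))
          (isIdealMulSection_restrictFunctor_map_idealMulι φ G K)).app V s) =
        (idealMulι G K).app (φ ''ᵁ V) (show Γ(idealMul G K, φ ''ᵁ V) from s) := fun s => rfl
  constructor
  · intro s s' h
    have h' := congrArg ((idealMulι (G.restrict φ) (K.comap φ)).app V) h
    rw [hval, hval] at h'
    exact idealMulι_app_injective G K (φ ''ᵁ V) h'
  · intro s'
    have hs' := isIdealMulSection_idealMulι_app (G.restrict φ) (K.comap φ) V s'
    obtain ⟨s, hs⟩ := exists_idealMulι_app_eq G K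
      (show Γ(G, φ ''ᵁ V) from (idealMulι (G.restrict φ) (K.comap φ)).app V s')
      (isIdealMulSection_image_of_restrict φ G K hs')
    refine ⟨show Γ((idealMul G K).restrict φ, V) from s, ?_⟩
    apply idealMulι_app_injective (G.restrict φ) (K.comap φ) V
    rw [hval]
    exact hs

/-- **`(𝒥M)|_Z ≅ 𝒥|_Z · M|_Z`**: the comparison morphism `(𝒥M)|_Z ⟶ 𝒥|_Z · M|_Z` is an isomorphism.
[cite: StacksProject, Tag 01CL (Modules, §17.13–17.15)] [cite: GortzWedhorn2020, (7.15) p. 186] -/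
theorem isIso_idealMulLift_restrict :
    IsIso (idealMulLift ((Scheme.Modules.restrictFunctor φ).map (idealMulι G K))
      (isIdealMulSection_restrictFunctor_map_idealMulι φ G K)) :=
  isIso_of_bijective_app_of_isAffineOpen _ fun V _ => idealMulLift_restrict_app_bijective φ G K V

/-- **`(𝒥M)|_Z ≅ 𝒥|_Z · M|_Z`** along an open immersion, as the existence of an isomorphism.
[cite: StacksProject, Tag 01CL (Modules, §17.13–17.15)] [cite: GortzWedhorn2020, (7.15) p. 186] -/
theorem nonempty_restrict_idealMul_iso :
    Nonempty ((idealMul G K).restrict φ ≅ idealMul (G.restrict φ) (K.comap φ)) :=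
  haveI := isIso_idealMulLift_restrict φ G K
  ⟨asIso (idealMulLift ((Scheme.Modules.restrictFunctor φ).map (idealMulι G K))
    (isIdealMulSection_restrictFunctor_map_idealMulι φ G K))⟩

/-- **Torsion-freeness passes to the restriction**: if no non-zero section of `M` over an affine open is
killed by `𝒥`, the same holds for `M|_Z` and `𝒥|_Z` (the restricted scalar action is the original one
through `Γ(W, 𝒪_Z) ≅ Γ(φW, 𝒪_{S′})`). [cite: StacksProject, Tag 01CL (Modules, §17.13–17.15)]
[cite: Hartshorne1977, II Prop. 5.4 (p. 113)] -/
theorem torsionFree_restrict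
    (htf : ∀ (V : S'.Opens) (hV : IsAffineOpen V) (q : Γ(G, V)),
      (∀ a ∈ K.ideal ⟨V, hV⟩, a • q = 0) → q = 0)
    (V : Z.Opens) (hV : IsAffineOpen V) (q : Γ(G.restrict φ, V))
    (hq : ∀ a ∈ (K.comap φ).ideal ⟨V, hV⟩, a • q = 0) : q = 0 := by
  have key := htf (φ ''ᵁ V) (hV.image_of_isOpenImmersion φ) (show Γ(G, φ ''ᵁ V) from q)
  apply key
  intro a' ha'
  have ha : (φ.appIso V).hom a' ∈ (K.comap φ).ideal ⟨V, hV⟩ := by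
    rw [Scheme.IdealSheafData.ideal_comap_of_isOpenImmersion, Ideal.mem_comap]
    change ((φ.appIso V).hom ≫ (φ.appIso V).inv) a' ∈ K.ideal ⟨φ ''ᵁ V, hV.image_of_isOpenImmersion φ⟩
    rw [Iso.hom_inv_id]
    exact ha'
  have h := hq _ ha
  rw [restrict_smul] at h
  change (((φ.appIso V).hom ≫ (φ.appIso V).inv) a' • (show Γ(G, φ ''ᵁ V) from q) : Γ(G, φ ''ᵁ V)) = 0 at h
  rwa [Iso.hom_inv_id] at h

end Literature.AlgebraicGeometry.Modules

end
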